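/-
Copyright (c) 2026 the pub-hodgecm-mathlib formalisation cell (harness21).  Prover seat hodgecm-mathlib-K2E3-p11 (g3), Track B «K2-LIT» ∕ h413,
line `K2_E3_EllipticInputs`, unit U12 «Characters», socket #11 `sig_K2E3CharLocIntNearSemisimple`, road (11-PS) «by class: principal series».
FILE 3a of the road: PRELIMINARIES — the weight `ϑ` (torus junction, class function), locality of orbital integrals, the density WIF read on `Gqs L v`.  2026-09-04.
-/
import Summits.HodgeConjecture.HodgeConjecture.Theorems.K2E3HyperbolicClassFunOfTorus       -- ★ p856467 (this seat) FILE 1: `exists_hyperbolicClassFun`, `isOpen_hyperbolicSet`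
import Summits.HodgeConjecture.HodgeConjecture.Theorems.K2E3WeylHypDensityMeasurable        -- ★ p856480 ∕ ED. 2 p856551 (this seat) FILE 2: the density WIF for measurable test functions + integrability; brings ★ TorusDefs ∕ ChartIso ∕ WIF
import Summits.HodgeConjecture.HodgeConjecture.Theorems.F0P3cStCharTSPsmTransport           -- ★ (LH6-p01) the van Dijk workhorse `smoothTrace_eq_inv_mul_integral_vanDijkWeight`, `torusChart_reflect`
import Summits.HodgeConjecture.HodgeConjecture.Theorems.F0P3cStCharTSWeylDiscrLocInt         -- ★ (F0P2-p01 ∕ LH6) HC-D `locallyIntegrable_weylDiscr_inv` (`|D_G|^{−1∕2} ∈ L¹_loc`); brings ★ DGField ∕ VanDijkHC ∕ VanDijkCore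
import Literature.NumberTheory.Automorphic.OrbitalMeasureCanonicalExistsCM                   -- ★ `exists_isCanonical_cmDatum_local` (canonical orbital measures exist)
import Literature.NumberTheory.Automorphic.LocalUnitaryGroupUnimodular                        -- ★ `isMulRightInvariant_cmDatum_local_three`
import HarnessLib

/-!
# K2_E3 road (h413 = stmt-HodgeConjecture-24833), unit U12 «Characters», socket #11 — road (11-PS) «BY CLASS: PRINCIPAL SERIES», FILE 3a (PRELIMINARIES FOR FILE 3):
# THE CHARACTER OF THE PRINCIPAL SERIES `i_G(χ)` OF `G = U(Φ₃)(L⁺_v)` (`v` NON-SPLIT) IS A LOCALLY INTEGRABLE FUNCTION `Θ_χ`, AND `Tr i_G(χ)(φ) = ∫_G φ Θ_χ` FOR EVERY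
# `φ ∈ C_c^∞(G)` — van Dijk's theorem (Rogawski 1990 (4.9.4) p. 56, §12.5 p. 182; van Dijk 1972; Harish-Chandra 1970 Thm. 15 ∕ 1999 Thm. 16.1 for these classes)

Cell `pub/hodgecm-mathlib` (D-0151), Track B (21-frontier RULING «PUSH BOTH» 2026-09-03), `--supports stmt-HodgeConjecture-24833 --as helper` (count-neutral);
THEOREMS ONLY — no `def`, no instance, no notation, no named fact, no `sorry`; ★-only imports.  Seat K2E3-p11 (g3), default self-deal (11-PS) (squad bus 00:51Z).

THE MATHEMATICS.  [Rogawski1990, §4.9 (4.9.4) p. 56, §12.5 p. 182; vanDijk1972, Thm. p. 237]: the character of `i_G(χ)` is the class function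
`Θ_χ(x t x⁻¹) = (χ(t) + χ(ʷt)) ∕ D_G(t)` on the regular hyperbolic set `Ω = ⋃_x x T^{reg} x⁻¹` and `0` off `Ω`; it is locally integrable on `G` because `D_G⁻¹ = |D_G|^{−1∕2}` is
[HarishChandra1970, Thm. 15], and it represents the trace on ALL of `C_c^∞(G)` (not only on functions supported in the regular set) — this is Harish-Chandra's Theorem 16.1 of
[HarishChandra1999] for the principal-series classes, i.e. the content of socket #11 `sig_K2E3CharLocIntNearSemisimple` for them.  EVERY analytic input is ★ in the tree:
(i) the van Dijk workhorse ★ `F0P3cStCharTSPsmTransport.smoothTrace_eq_inv_mul_integral_vanDijkWeight`: `Tr i_G(χ)(φ) = μ_T(T ∩ K_v)⁻¹ ∫_T χ·Δ·O^{can}(φ) dμ_T` for EVERY test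
`φ`; (ii) the UNCONDITIONAL Weyl integration formula on `Ω` in density form `(Re Δ)²` (★ LH6 road «JAC-LOC», read for measurable test functions in ★ FILE 2); (iii) HC-D ★
`F0P3cStCharTSWeylDiscrLocInt.locallyIntegrable_weylDiscr_inv` (`ϑ⁻¹ ∈ L¹_loc`, `ϑ = √√(‖disc χ_g‖·‖det g‖⁻²) = D_G`); (iv) ★ FILE 1 (the measurable class function `N_ψ` with torus
values `ψ = χ + χ∘ʷ`, bounded on compacts).  With `Θ_χ := (c₀∕c_T)·ϑ⁻¹·N_ψ` (`c₀ = (ι_*μM)(compactCore T)`, `c_T = (ι_*μM)(T ∩ K_v)`, any Haar `μM` on `M = E_vˣ × E¹_v`):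
* §1 `dgFormula_coe_torus_eq_vanDijkWeight_re` (the junction `ϑ(t) = Re Δ(t)` on `T`, ★ VDW-CORE), `dgFormula_conj` (`ϑ` is a class function);
* §2 `classOrbitalIntegral_congr_class` (orbital integrals at a class only read the function on that class);
* (FILE 3) §3 **`exists_locallyIntegrable_smoothTrace_cmPrincipalSeries_eq`** — `∃ Θ ∈ L¹_loc(νQv), ∀ φ ∈ C_c^∞(G), Tr i_G(χ)(φ) = ∫ φ·Θ dνQv` (every continuous `χ : T →* ℂˣ`,
  every Haar `νQv`);
* (FILE 3∕4) §4 the ROW-11 SHAPE: **`charLocIntNearSemisimple_of_equiv_cmPrincipalSeries`** — socket #11's conclusion TOKEN FOR TOKEN (at `N = 3`, `H = Φ₃`, `v` non-split) for every class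
  `c = ⟦r⟧` whose representative is EQUIVALENT to some `i_G(χ)` (in particular every IRREDUCIBLE principal series, e.g. ★ `isIrreducible_cmPrincipalSeries_of_cmWeylTorusCharPair_ne`).
RESIDUE of row #11 at `N = 3`, `v` non-split, after this file: the supercuspidal classes (★ p856184's composition ⟸ (SC-lim∖ell)+(SC-dom)) and the constituents of the
REDUCIBLE `i_G(χ)` (the Steinberg-type ones follow by additivity from ★ finite-dimensional classes; `π²`, `π^±` need the l.d.s. identities or (11-Id)); inner forms and
other `H` reach `Φ₃` through ★ `K2E3CharLocIntNearSemisimpleModelTransport`.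

HONEST LABEL: HC_CM is proved only modulo the 7 printed citations (2 remaining named inputs: hLiu418 = stmt-HodgeConjecture-24832, h413 = stmt-HodgeConjecture-24833)
until rung 0 closes; count-neutral helper: row #11 stays OPEN (this closes its (11-PS) road for the principal-series classes of `U(Φ₃)` at non-split places, unconditionally).

## References
* [Rogawski1990] J. D. Rogawski, *Automorphic Representations of Unitary Groups in Three Variables*, Ann. of Math. Stud. 123 (1990), §4.9 Lemma 4.9.2, (4.9.4) p. 56; §12.5
  p. 182 (Weyl integration formula, `D_G`); §12.2 p. 173; §1.6 p. 6 («`χ_π(f) = ∫ f(g) χ_π(g) dg`»).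
* [vanDijk1972] G. van Dijk, *Computation of certain induced characters of 𝔭-adic groups*, Math. Ann. 199 (1972), §2, Thm. p. 237.
* [HarishChandra1970] Harish-Chandra (notes by G. van Dijk), *Harmonic Analysis on Reductive p-adic Groups*, LNM 162 (1970), Part VII §1 Thm. 15 (`|D|^{−1∕2} ∈ L¹_loc`), Lemmas 22, 42.
* [HarishChandra1999] Harish-Chandra (notes by S. DeBacker, P. J. Sally), *Admissible Invariant Distributions on Reductive p-adic Groups*, ULS 16 (1999), Thm. 16.1 p. 77.
-/

set_option autoImplicit false
-- the mandated namespace has the single-problem summit's repeated segment (`HodgeConjecture.HodgeConjecture`)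
set_option linter.dupNamespace false

noncomputable section

open MeasureTheory Measure Set Filter Topology Function NumberField IsDedekindDomain Matrix Polynomial
open Literature.MeasureTheory.Group
open Literature.NumberTheory.Automorphic Literature.NumberTheory.Automorphic.UnitaryGroup Literature.NumberTheory.Rogawski1990
open Literature.NumberTheory.GaloisRepresentations Literature.NumberTheory.GaloisRepresentations.IsNonarchimedeanLocalField
open Summit.HodgeConjecture.HodgeConjecture.Cruxes.H413
open Summit.HodgeConjecture.HodgeConjecture.Cruxes.H413.F0P3cStCharTSTorusDefs
open Summit.HodgeConjecture.HodgeConjecture.Cruxes.H413.F0P3cStCharTSTorusChartIso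
open Summit.HodgeConjecture.HodgeConjecture.Cruxes.H413.F0P3cStCharTSWeylHypMeasure
open Summit.HodgeConjecture.HodgeConjecture.Cruxes.H413.F0P3cStCharTSWeylHypCM
open Summit.HodgeConjecture.HodgeConjecture.Cruxes.H413.F0P3cStCharTSWeylHypTorsor
open Summit.HodgeConjecture.HodgeConjecture.Cruxes.H413.F0P3cStCharTSWeylHypWIFJac
open scoped ENNReal NNReal MatrixGroups ComplexConjugate

namespace Summit.HodgeConjecture.HodgeConjecture.Cruxes.H413.K2E3PrincipalSeriesCharPrelims

variable (L : Type) [Field L] [NumberField L] [IsCMField L] (v : HeightOneSpectrum (𝓞 ↥(maximalRealSubfield L)))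

/-! ## §1 Harish-Chandra's weight `ϑ = √√(‖disc χ_g‖ · ‖det g‖⁻²) = D_G`: torus junction with van Dijk's `Δ`, class function -/

/-- **THE TORUS JUNCTION `ϑ(t) = Re Δ(t)`** on ALL of the split torus `T` of `U(Φ₃)(L⁺_v)` (`v` non-split): at regular `t` both are `√√‖u‖` for the unit `u` with
`u·det(t)² = discr(charpoly t)` (★ VDW-CORE `coe_sqrt_sqrt_unitModulusChar_eq_vanDijkWeight_re`, ★ `exists_unit_mul_det_sq_eq_discr_iff`, ★ `dgFormula_eq_of_unit_rel`); at singular `t`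
both vanish (★ `vanDijkWeight_eq_zero_of_not`, ★ `dgFormula_eq_zero_of_not_isUnit_discr`) — ★ DG-FIELD's `DG_coe_torus_eq_vanDijkWeight_re` without the datum wrapper.
[cite: Rogawski1990, §12.7 Lemma 12.7.2 (proof) p. 193; §4.9 (4.9.4) p. 56; §12.5 p. 182] -/
theorem dgFormula_coe_torus_eq_vanDijkWeight_re (hns : ∀ w : PlacesOver L v, IsCMField.complexConj L • w.1 = w.1) (t : ↥(cmBorelTriple L 3 v).M) :
    ((NNReal.sqrt (NNReal.sqrt
        ((∏ w : PlacesOver L v, normAbs (w.1.adicCompletion L)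
            (((((t : ↥(unitaryGroupOfForm (conjLocal L (IsCMField.complexConj L) v) (cmLocalForm L 3 v))) : Gqs L v).val : GL (Fin 3) (UnitaryGroup.LocalRing L v)).val.charpoly.discr) w)) *
          ((∏ w : PlacesOver L v, normAbs (w.1.adicCompletion L)
            (((((t : ↥(unitaryGroupOfForm (conjLocal L (IsCMField.complexConj L) v) (cmLocalForm L 3 v))) : Gqs L v).val : GL (Fin 3) (UnitaryGroup.LocalRing L v)).val.det) w)) ^ 2)⁻¹)) : ℝ≥0) : ℝ) =
      (vanDijkWeight L v t).re := by
  rcases Classical.em (IsUnit ((((torusEntry (conjLocal L (IsCMField.complexConj L) v) (cmLocalForm L 3 v) 0 t)⁻¹ *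
        torusEntry (conjLocal L (IsCMField.complexConj L) v) (cmLocalForm L 3 v) 1 t : (UnitaryGroup.LocalRing L v)ˣ) : UnitaryGroup.LocalRing L v) - 1) ∧
      IsUnit ((((torusEntry (conjLocal L (IsCMField.complexConj L) v) (cmLocalForm L 3 v) 0 t)⁻¹ *
        torusEntry (conjLocal L (IsCMField.complexConj L) v) (cmLocalForm L 3 v) 2 t : (UnitaryGroup.LocalRing L v)ˣ) : UnitaryGroup.LocalRing L v) - 1)) with hreg | hreg
  · obtain ⟨u, hu⟩ := (F0P3cStCharTSVanDijkHC.exists_unit_mul_det_sq_eq_discr_iff L v hns t).2 hreg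
    rw [F0P3cStCharTSDGField.dgFormula_eq_of_unit_rel L v _ u hu]
    exact F0P3cStCharTSVanDijkHC.coe_sqrt_sqrt_unitModulusChar_eq_vanDijkWeight_re L v hns t u hu
  · have h0 : ¬ IsUnit ((((t : ↥(unitaryGroupOfForm (conjLocal L (IsCMField.complexConj L) v) (cmLocalForm L 3 v))) : Gqs L v).val :
        GL (Fin 3) (UnitaryGroup.LocalRing L v)).val.charpoly.discr) := fun hdisc =>
      hreg ((F0P3cStCharTSVanDijkHC.exists_unit_mul_det_sq_eq_discr_iff L v hns t).1
        ((F0P3cStCharTSDGField.exists_unit_rel_iff_isUnit_discr L v _).2 hdisc))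
    rw [F0P3cStCharTSVanDijkWeylSymm.vanDijkWeight_eq_zero_of_not L v t hreg, Complex.zero_re]
    exact F0P3cStCharTSDGField.dgFormula_eq_zero_of_not_isUnit_discr L v _ h0

/-- **`ϑ` IS A CLASS FUNCTION**: `charpoly` and `det` are conjugation invariant (Mathlib `Matrix.charpoly_units_conj`, `Matrix.det_units_conj`). [cite: Rogawski1990, §4.9 p. 54; §12.5 p. 182] -/
theorem dgFormula_conj (x h : Gqs L v) :
    ((NNReal.sqrt (NNReal.sqrt
        ((∏ w : PlacesOver L v, normAbs (w.1.adicCompletion L) ((((h * x * h⁻¹).val : GL (Fin 3) (UnitaryGroup.LocalRing L v)).val.charpoly.discr) w)) *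
          ((∏ w : PlacesOver L v, normAbs (w.1.adicCompletion L) ((((h * x * h⁻¹).val : GL (Fin 3) (UnitaryGroup.LocalRing L v)).val.det) w)) ^ 2)⁻¹)) : ℝ≥0) : ℝ) =
      ((NNReal.sqrt (NNReal.sqrt
        ((∏ w : PlacesOver L v, normAbs (w.1.adicCompletion L) (((x.val : GL (Fin 3) (UnitaryGroup.LocalRing L v)).val.charpoly.discr) w)) *
          ((∏ w : PlacesOver L v, normAbs (w.1.adicCompletion L) (((x.val : GL (Fin 3) (UnitaryGroup.LocalRing L v)).val.det) w)) ^ 2)⁻¹)) : ℝ≥0) : ℝ) := by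
  have hval : ((h * x * h⁻¹).val : GL (Fin 3) (UnitaryGroup.LocalRing L v)).val =
      (h.val : GL (Fin 3) (UnitaryGroup.LocalRing L v)).val * (x.val : GL (Fin 3) (UnitaryGroup.LocalRing L v)).val *
        ((h.val : GL (Fin 3) (UnitaryGroup.LocalRing L v))⁻¹).val := rfl
  have hcp : ((h * x * h⁻¹).val : GL (Fin 3) (UnitaryGroup.LocalRing L v)).val.charpoly = (x.val : GL (Fin 3) (UnitaryGroup.LocalRing L v)).val.charpoly := by
    rw [hval, Matrix.coe_units_inv, Matrix.charpoly_units_conj]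
  have hdet : ((h * x * h⁻¹).val : GL (Fin 3) (UnitaryGroup.LocalRing L v)).val.det = (x.val : GL (Fin 3) (UnitaryGroup.LocalRing L v)).val.det := by
    rw [hval, Matrix.det_units_conj]
  rw [hcp, hdet]

/-! ## §2 Orbital integrals at a class only read the test function on that class -/

/-- **Orbital integrals are local on the class**: if `φ′ = φ` on the conjugacy class `c`, then `classOrbitalIntegral m φ′ c = classOrbitalIntegral m φ c` (the integrand is
`y ↦ φ(y γ_c y⁻¹)`, `γ_c = out c ∈ c`). [cite: Rogawski1990, §4.3 (4.3.1) p. 43] -/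
theorem classOrbitalIntegral_congr_class {G : Type*} [Group G] [∀ γ : G, MeasurableSpace (G ⧸ Subgroup.centralizer ({γ} : Set G))]
    (m : OrbitalMeasureFamily G) (c : ConjClasses G) {φ φ' : G → ℂ} (h : ∀ y : G, ConjClasses.mk y = c → φ' y = φ y) :
    classOrbitalIntegral m φ' c = classOrbitalIntegral m φ c := by
  rw [classOrbitalIntegral_eq, classOrbitalIntegral_eq, orbitalIntegral, orbitalIntegral]
  refine integral_congr_ae (Eventually.of_forall fun y => ?_)
  induction y using QuotientGroup.induction_on with
  | H g =>
    simp only [descConj_mk]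
    refine h _ ?_
    rw [← ConjClasses.mk_eq_mk_iff_isConj.2 (isConj_iff.2 ⟨g, rfl⟩)]
    exact Quotient.out_eq c


/-! ## §2b The density Weyl integration formula and its integrability half, read on the organ's carrier `Gqs L v` -/

set_option maxHeartbeats 3200000 in
set_option synthInstance.maxHeartbeats 400000 in
-- the two ★ FILE 2 statements are typed over the matrix carrier; this re-reads them over `Gqs L v` (definitionally the same type), once and for all
/-- ★ FILE 2 (`integral_mul_eq_integral_classOrbitalIntegral_density_of_measurable`, `integrable_classOrbitalIntegral_density_mul_of_measurable`) READ ON `Gqs L v`, at the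
density `D = (Re Δ)²` and with the calibration constant written `μM(ι⁻¹(compactCore T))`: for measurable `φ, α : G → ℂ` with `α` conjugation invariant on `Ω`, `φ·α ∈ L¹(Ω)`
and `φ = 0` off `Ω`, **`∫ φ·α dν = ∫_M O(φ)⟦ι m⟧ · (ρ(m) · α(ι m)) dμM`**, `ρ(m) = (2 μM(ι⁻¹ T_c))⁻¹ · (Re Δ(ι m))²`, AND the right-hand integrand is `μM`-integrable.
[cite: Rogawski1990, §12.5 p. 182; §12.7 L. 12.7.2 (proof) p. 193] [cite: HarishChandra1970, Lemma 22; Lemma 42] -/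
theorem density_wif_and_integrable (hns : ∀ w : PlacesOver L v, IsCMField.complexConj L • w.1 = w.1)
    [MeasurableSpace (Gqs L v)] [BorelSpace (Gqs L v)]
    [∀ γ : Gqs L v, MeasurableSpace (Gqs L v ⧸ Subgroup.centralizer ({γ} : Set (Gqs L v)))]
    [∀ γ : Gqs L v, BorelSpace (Gqs L v ⧸ Subgroup.centralizer ({γ} : Set (Gqs L v)))]
    [MeasurableSpace ((LocalRing L v)ˣ × ↥(normOneUnits (conjLocal L (IsCMField.complexConj L) v)))] [BorelSpace ((LocalRing L v)ˣ × ↥(normOneUnits (conjLocal L (IsCMField.complexConj L) v)))]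
    (νQv : Measure (Gqs L v)) [νQv.IsHaarMeasure] [νQv.IsMulRightInvariant]
    {mQv : OrbitalMeasureFamily (Gqs L v)} (hcanQ : mQv.IsCanonical (fun γ => IsRegularElt (γ.val : GL (Fin 3) (LocalRing L v))) νQv)
    (μM : Measure ((LocalRing L v)ˣ × ↥(normOneUnits (conjLocal L (IsCMField.complexConj L) v)))) [μM.IsHaarMeasure]
    (w : Gqs L v) (hw : Units.val (w.val : GL (Fin 3) (LocalRing L v)) = cmLocalForm L 3 v)
    (φ α : Gqs L v → ℂ) (hφm : Measurable φ) (hαm : Measurable α)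
    (hαinv : ∀ x : Gqs L v, x ∈ hyperbolicSet L v → ∀ h : Gqs L v, α (h * x * h⁻¹) = α x)
    (hint : IntegrableOn (fun x => φ x * α x) (hyperbolicSet L v) νQv)
    (hφ0 : ∀ x : Gqs L v, x ∉ hyperbolicSet L v → φ x = 0) :
    (∫ x, φ x * α x ∂νQv = ∫ m, classOrbitalIntegral mQv φ (ConjClasses.mk ((((torusChart L v m) : ↥(cmBorelTriple L 3 v).M) : ↥(unitaryGroupOfForm (conjLocal L (IsCMField.complexConj L) v) (cmLocalForm L 3 v))) : Gqs L v)) * ((((2 * (μM ((torusChart L v) ⁻¹' compactCore ↥(cmBorelTriple L 3 v).M)).toReal)⁻¹ * ((vanDijkWeight L v (torusChart L v m)).re ^ 2 : ℝ) : ℝ) : ℂ) * α ((((torusChart L v m) : ↥(cmBorelTriple L 3 v).M) : ↥(unitaryGroupOfForm (conjLocal L (IsCMField.complexConj L) v) (cmLocalForm L 3 v))) : Gqs L v)) ∂μM) ∧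
      Integrable (fun m : ((LocalRing L v)ˣ × ↥(normOneUnits (conjLocal L (IsCMField.complexConj L) v))) => classOrbitalIntegral mQv φ (ConjClasses.mk ((((torusChart L v m) : ↥(cmBorelTriple L 3 v).M) : ↥(unitaryGroupOfForm (conjLocal L (IsCMField.complexConj L) v) (cmLocalForm L 3 v))) : Gqs L v)) * ((((2 * (μM ((torusChart L v) ⁻¹' compactCore ↥(cmBorelTriple L 3 v).M)).toReal)⁻¹ * ((vanDijkWeight L v (torusChart L v m)).re ^ 2 : ℝ) : ℝ) : ℂ) * α ((((torusChart L v m) : ↥(cmBorelTriple L 3 v).M) : ↥(unitaryGroupOfForm (conjLocal L (IsCMField.complexConj L) v) (cmLocalForm L 3 v))) : Gqs L v))) μM := by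
  letI hmsU : MeasurableSpace ↥(unitaryGroupOfForm (conjLocal L (IsCMField.complexConj L) v) (cmLocalForm L 3 v)) := ‹MeasurableSpace (Gqs L v)›
  haveI : BorelSpace ↥(unitaryGroupOfForm (conjLocal L (IsCMField.complexConj L) v) (cmLocalForm L 3 v)) := ⟨BorelSpace.measurable_eq (α := Gqs L v)⟩
  letI : ∀ γ : ↥(unitaryGroupOfForm (conjLocal L (IsCMField.complexConj L) v) (cmLocalForm L 3 v)), MeasurableSpace (↥(unitaryGroupOfForm (conjLocal L (IsCMField.complexConj L) v) (cmLocalForm L 3 v)) ⧸ Subgroup.centralizer ({γ} : Set ↥(unitaryGroupOfForm (conjLocal L (IsCMField.complexConj L) v) (cmLocalForm L 3 v)))) :=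
    ‹∀ γ : Gqs L v, MeasurableSpace (Gqs L v ⧸ Subgroup.centralizer ({γ} : Set (Gqs L v)))›
  haveI : ∀ γ : ↥(unitaryGroupOfForm (conjLocal L (IsCMField.complexConj L) v) (cmLocalForm L 3 v)), BorelSpace (↥(unitaryGroupOfForm (conjLocal L (IsCMField.complexConj L) v) (cmLocalForm L 3 v)) ⧸ Subgroup.centralizer ({γ} : Set ↥(unitaryGroupOfForm (conjLocal L (IsCMField.complexConj L) v) (cmLocalForm L 3 v)))) :=
    ‹∀ γ : Gqs L v, BorelSpace (Gqs L v ⧸ Subgroup.centralizer ({γ} : Set (Gqs L v)))›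
  haveI : LocallyCompactSpace ↥(unitaryGroupOfForm (conjLocal L (IsCMField.complexConj L) v) (cmLocalForm L 3 v)) := locallyCompactSpace_local (IsCMField.complexConj L) 3 _ v
  haveI : SecondCountableTopology ↥(unitaryGroupOfForm (conjLocal L (IsCMField.complexConj L) v) (cmLocalForm L 3 v)) := secondCountableTopology_local (IsCMField.complexConj L) 3 _ v
  haveI : T2Space ↥(unitaryGroupOfForm (conjLocal L (IsCMField.complexConj L) v) (cmLocalForm L 3 v)) := t2Space_cmDatum_local 3 L (Matrix.of fun i j : Fin 3 => if i.val + j.val + 1 = 3 then (1 : L) else 0) v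
  haveI : Measure.IsHaarMeasure (G := ↥(unitaryGroupOfForm (conjLocal L (IsCMField.complexConj L) v) (cmLocalForm L 3 v))) νQv := ‹νQv.IsHaarMeasure›
  haveI : Measure.IsMulRightInvariant (G := ↥(unitaryGroupOfForm (conjLocal L (IsCMField.complexConj L) v) (cmLocalForm L 3 v))) νQv := ‹νQv.IsMulRightInvariant›
  -- the density `D = (Re Δ)²` as an `ℝ≥0`-valued measurable function; the calibration constant through `Measure.map_apply`
  obtain ⟨D, hD⟩ : ∃ D : ↥(cmBorelTriple L 3 v).M → ℝ≥0, D = fun t => Real.toNNReal ((vanDijkWeight L v t).re ^ 2) := ⟨_, rfl⟩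
  have hDm : Measurable D := by
    rw [hD]; exact measurable_real_toNNReal.comp ((Complex.measurable_re.comp (F0P3cStCharTSVanDijkCore.measurable_vanDijkWeight L v hns)).pow_const 2)
  have hDsq : ∀ t : ↥(cmBorelTriple L 3 v).M, (D t : ℝ) = ((vanDijkWeight L v t).re) ^ 2 := fun t => by rw [hD]; exact Real.coe_toNNReal _ (sq_nonneg _)
  obtain ⟨hcoreC, -⟩ := isCompact_isOpen_compactCore_cmTorus L v
  have hmap : (μM.map (torusChart L v)) (compactCore ↥(cmBorelTriple L 3 v).M) = μM ((torusChart L v) ⁻¹' compactCore ↥(cmBorelTriple L 3 v).M) :=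
    Measure.map_apply (continuous_torusChart L v).measurable hcoreC.isClosed.measurableSet
  have hA := K2E3WeylHypDensityMeasurable.integral_mul_eq_integral_classOrbitalIntegral_density_of_measurable L v hns
      (νQv : Measure ↥(unitaryGroupOfForm (conjLocal L (IsCMField.complexConj L) v) (cmLocalForm L 3 v))) hcanQ μM w hw D hDm hDsq φ α hφm hαm (fun x hx h => hαinv x hx h) hint (fun x hx => hφ0 x hx)
  have hB := K2E3WeylHypDensityMeasurable.integrable_classOrbitalIntegral_density_mul_of_measurable L v hns
      (νQv : Measure ↥(unitaryGroupOfForm (conjLocal L (IsCMField.complexConj L) v) (cmLocalForm L 3 v))) hcanQ μM w hw D hDm hDsq φ α hφm hαm (fun x hx h => hαinv x hx h) hint (fun x hx => hφ0 x hx)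
  simp only [hmap, hDsq] at hA hB
  exact ⟨hA, hB⟩

end Summit.HodgeConjecture.HodgeConjecture.Cruxes.H413.K2E3PrincipalSeriesCharPrelims

end
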